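import Mathlib
import Literature.NumberTheory.Transcendental.KZCalculus
import Summits.KontsevichZagierPeriods.KontsevichZagierPeriods.Theorems.TorsionLogsNeronTorsionSectorStubProductCoV
import HarnessLib

/-!
# Crux `TorsionLogs.NeronTorsionSector` (stmt-KontsevichZagierPeriods-14500) — assembly, column shifts

Helper for the lead's stub `stub_assembly` (line `registered`): the u-translation of the chain is FREE — a cell
`[A × B, h(x′)/(√f x √f x′)]` of the second-kind plane representation is KZ-equivalent to the translated cell
`[τ(A) × B, same]` by one change of variables in the Haar variable (the landed `stub_productCoV`, Haar identity
`|τ′|√f = √f∘τ`). [cite: KontsevichZagier2001, §1.2 rule (2)]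
-/

noncomputable section

open Set MeasureTheory
open Literature.NumberTheory.Transcendental Literature.NumberTheory.Transcendental.KZ
open Literature.ModelTheory.ExponentialFields

-- `Summit.KontsevichZagierPeriods.KontsevichZagierPeriods.…` is the tree's mandated layout (single-conjunct summit).
set_option linter.dupNamespace false

namespace Summit.KontsevichZagierPeriods.KontsevichZagierPeriods.Cruxes.NeronTorsionSector.Translation

/-- The image of a product set under a map acting on the first coordinate only. [folklore] -/
theorem asmCol_image_row {φ : ℝ → ℝ} {A B : Set ℝ} :
    {z : Fin 2 → ℝ | z 0 ∈ φ '' A ∧ z 1 ∈ B} =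
      (fun z : Fin 2 → ℝ => (![φ (z 0), z 1] : Fin 2 → ℝ)) '' {z | z 0 ∈ A ∧ z 1 ∈ B} := by
  ext w
  simp only [Set.mem_setOf_eq, Set.mem_image]
  constructor
  · rintro ⟨⟨a, ha, hwa⟩, hb⟩
    refine ⟨![a, w 1], ⟨by simpa using ha, by simpa using hb⟩, ?_⟩
    ext i; fin_cases i <;> simp [hwa]
  · rintro ⟨z, ⟨hz0, hz1⟩, rfl⟩
    exact ⟨⟨z 0, hz0, by simp⟩, by simpa using hz1⟩

/-- **Column shift.** For the lower translation `τ` mapping `A` injectively onto `A′` with the Haar identity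
`|τ′|√f = √f∘τ` on `A` (`f > 0` on `A` and on `τ(A)`), two plane representations with domains `A × B`, `A′ × B`
and the second-kind integrand `h(z 1)/(√f(z 0)√f(z 1))` on their domains differ by a relation.
[cite: KontsevichZagier2001, §1.2 rule (2)] -/
theorem asmCol_shift : ∀ (g₂ g₃ : ℝ) (f τ τ' : ℝ → ℝ) (A A' B : Set ℝ) (r r' : Literature.NumberTheory.Transcendental.KZ.IntegralRep 2), IsSemialgebraic ℚ {p : Fin 1 → ℝ | p 0 ∈ A} → IsSemialgebraicFunOn ℚ {p : Fin 1 → ℝ | p 0 ∈ A} (fun p => τ (p 0)) → Set.InjOn τ A → τ '' A = A' → (∀ t ∈ A, HasDerivAt τ (τ' t) t ∧ |τ' t| * Real.sqrt (f t) = Real.sqrt (f (τ t)) ∧ 0 < f t ∧ 0 < f (τ t)) → r.domain = {z | z 0 ∈ A ∧ z 1 ∈ B} → r'.domain = {z | z 0 ∈ A' ∧ z 1 ∈ B} → Set.EqOn r.integrand (fun z => (g₂ * z 1 + 2 * g₃) / (4 * (z 1) ^ 2) / (Real.sqrt (f (z 0)) * Real.sqrt (f (z 1)))) r.domain → Set.EqOn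 r'.integrand (fun z => (g₂ * z 1 + 2 * g₃) / (4 * (z 1) ^ 2) / (Real.sqrt (f (z 0)) * Real.sqrt (f (z 1)))) r'.domain → Literature.NumberTheory.Transcendental.KZ.of r - Literature.NumberTheory.Transcendental.KZ.of r' ∈ Literature.NumberTheory.Transcendental.KZ.relations := by
  intro g₂ g₃ f τ τ' A A' B r r' hA hτσ hinj himg hfacts hrd hr'd hri hr'i
  refine stub_productCoV τ τ' A r.domain r r' hA hτσ hinj (fun t ht => (hfacts t ht).1)
    (by rw [hrd]; exact fun z hz => hz.1) rfl (by rw [hr'd, hrd, ← himg]; exact asmCol_image_row) fun z hz => ?_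
  have hz' := hz
  rw [hrd] at hz'
  obtain ⟨_, hhaar, hf0, hfτ⟩ := hfacts (z 0) hz'.1
  have hT0 : |τ' (z 0)| ≠ 0 := by
    intro h; rw [h, zero_mul] at hhaar; exact (Real.sqrt_pos.2 hfτ).ne' hhaar.symm
  have hmem : (![τ (z 0), z 1] : Fin 2 → ℝ) ∈ r'.domain := by
    rw [hr'd, ← himg]; exact ⟨⟨z 0, hz'.1, by simp⟩, by simpa using hz'.2⟩
  rw [hri hz, hr'i hmem]
  simp only [Matrix.cons_val_zero, Matrix.cons_val_one]
  rw [← hhaar, div_mul_eq_mul_div, show |τ' (z 0)| * Real.sqrt (f (z 0)) * Real.sqrt (f (z 1)) =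
    |τ' (z 0)| * (Real.sqrt (f (z 0)) * Real.sqrt (f (z 1))) by ring,
    mul_comm ((g₂ * z 1 + 2 * g₃) / (4 * z 1 ^ 2)), mul_div_mul_left _ _ hT0]

end Summit.KontsevichZagierPeriods.KontsevichZagierPeriods.Cruxes.NeronTorsionSector.Translation
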